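import Summits.KontsevichZagierPeriods.KontsevichZagierPeriods.Theses.FurushoPentagon

/-!
# Stuffle dissection — auxiliary algebra (stub `stub_stuffleDissection`, line `dilation-homotopy-transposition`)

Pure finite-product algebra behind the stuffle side of Hoffman's relation in the KZ calculus:
with block products `a l` (`a 0 = 1`, `a l ∈ (0,1)` for `l ≥ 1`) and the extra variable `u ∈ (0,1)`,
the difference quotient `(f − u f∘σ_u)/(1 − u)` of the cubical integrand `f = ∏_{l<k} a_l/(1 − a_{l+1})`
is the sum over the blocks `i < k` of the cubical integrands `g_i` (index raised at block `i`) and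
`h_i` (a block `1` inserted after block `i`), read at the point with `u` inserted into the cube
(`stuffle_telescope`, registered as the sub-goal stub `stub_stuffleTelescope`). Then the coordinate
bookkeeping: partial products of a point of the cube read at a coordinate-permuted point
(`Fin.cycleRange`: the variable `u = y 0` moved to a slot `P`) and at the sheared point `(c x₀, x₁, …)`,
and the block ends (partial sums) of the raised index `(…, s_i + 1, …)` and of the inserted index
`(…, s_{i+1}, 1, …)` in the crux's `take/getD/drop` spelling.
-/

noncomputable section

open Finset
open Literature.NumberTheory.Transcendental

namespace Summit.KontsevichZagierPeriods.FurushoPentagon.HoffmanRelationInKZ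

/-- `∏_{l<k} (if l ≤ i then 1 else u) = u^{k-1-i}`. [folklore] -/
theorem prod_range_ite_le_one (k i : ℕ) (u : ℝ) :
    ∏ l ∈ range k, (if l ≤ i then (1 : ℝ) else u) = u ^ (k - 1 - i) := by
  induction k with
  | zero => simp
  | succ k ih =>
    rw [prod_range_succ, ih]
    by_cases hk : k ≤ i
    · rw [if_pos hk, mul_one]
      have h1 : k - 1 - i = 0 := by omega
      have h2 : k + 1 - 1 - i = 0 := by omega
      rw [h1, h2]
    · rw [if_neg hk, ← pow_succ]
      congr 1
      omega

/-- Numerator of the raised block integrand: `∏_{l<k} (l ≤ i ? a_l : u a_l) = u^{k-1-i} ∏_{l<k} a_l`.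
[folklore] -/
theorem prod_range_raiseNum (k i : ℕ) (u : ℝ) (a : ℕ → ℝ) :
    ∏ l ∈ range k, (if l ≤ i then a l else u * a l) = u ^ (k - 1 - i) * ∏ l ∈ range k, a l := by
  rw [← prod_range_ite_le_one k i u, ← prod_mul_distrib]
  refine prod_congr rfl fun l _ => ?_
  split_ifs <;> ring

/-- Numerator of the inserted block integrand: `∏_{l<k+1} (l ≤ i+1 ? a_l : u a_{l-1}) = a_{i+1} · ∏_{l<k} (l ≤ i ? a_l : u a_l)`
for `i < k`. [folklore] -/
theorem prod_range_insertNum {k i : ℕ} (hi : i < k) (u : ℝ) (a : ℕ → ℝ) :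
    ∏ l ∈ range (k + 1), (if l ≤ i + 1 then a l else u * a (l - 1)) =
      a (i + 1) * ∏ l ∈ range k, (if l ≤ i then a l else u * a l) := by
  rw [← Fin.prod_univ_eq_prod_range (fun l => if l ≤ i + 1 then a l else u * a (l - 1)) (k + 1),
    ← Fin.prod_univ_eq_prod_range (fun l => if l ≤ i then a l else u * a l) k,
    Fin.prod_univ_succAbove _ ⟨i + 1, by omega⟩]
  simp only [le_refl, if_true]
  congr 1
  refine Finset.prod_congr rfl fun l _ => ?_
  by_cases hl : (l : ℕ) ≤ i
  · have hlt : Fin.castSucc l < (⟨i + 1, by omega⟩ : Fin (k + 1)) := by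
      rw [Fin.lt_def, Fin.val_castSucc]; exact Nat.lt_succ_of_le hl
    rw [Fin.succAbove_of_castSucc_lt _ _ hlt, Fin.val_castSucc, if_pos (by omega), if_pos hl]
  · have hle : (⟨i + 1, by omega⟩ : Fin (k + 1)) ≤ Fin.castSucc l := by
      rw [Fin.le_def, Fin.val_castSucc]; exact Nat.succ_le_of_lt (Nat.lt_of_not_le hl)
    rw [Fin.succAbove_of_le_castSucc _ _ hle, Fin.val_succ, if_neg (by omega), if_neg hl,
      Nat.add_sub_cancel]

/-- Denominator of the inserted block integrand: `∏_{l<k+1} (1 − (l ≤ i ? a_{l+1} : u a_l)) =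
(1 − a_{i+1}) · ∏_{l<k} (1 − (l+1 ≤ i ? a_{l+1} : u a_{l+1}))` for `i < k`. [folklore] -/
theorem prod_range_insertDen {k i : ℕ} (hi : i < k) (u : ℝ) (a : ℕ → ℝ) :
    ∏ l ∈ range (k + 1), (1 - (if l ≤ i then a (l + 1) else u * a l)) =
      (1 - a (i + 1)) * ∏ l ∈ range k, (1 - (if l + 1 ≤ i then a (l + 1) else u * a (l + 1))) := by
  rw [← Fin.prod_univ_eq_prod_range (fun l => 1 - (if l ≤ i then a (l + 1) else u * a l)) (k + 1),
    ← Fin.prod_univ_eq_prod_range (fun l => 1 - (if l + 1 ≤ i then a (l + 1) else u * a (l + 1))) k,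
    Fin.prod_univ_succAbove _ ⟨i, by omega⟩]
  simp only [le_refl, if_true]
  congr 1
  refine Finset.prod_congr rfl fun l _ => ?_
  by_cases hl : (l : ℕ) < i
  · have hlt : Fin.castSucc l < (⟨i, by omega⟩ : Fin (k + 1)) := by
      rw [Fin.lt_def, Fin.val_castSucc]; exact hl
    rw [Fin.succAbove_of_castSucc_lt _ _ hlt, Fin.val_castSucc, if_pos (by omega), if_pos (by omega)]
  · have hle : (⟨i, by omega⟩ : Fin (k + 1)) ≤ Fin.castSucc l := by
      rw [Fin.le_def, Fin.val_castSucc]; exact Nat.le_of_not_lt hl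
    rw [Fin.succAbove_of_le_castSucc _ _ hle, Fin.val_succ, if_neg (by omega), if_neg (by omega)]

/-- The two consecutive telescoping denominators: `Den_i · (1 − a_{i+1}) = Den_{i+1} · (1 − u a_{i+1})`
for `i < k`, where `Den_m = ∏_{l<k} (1 − (l+1 ≤ m ? a_{l+1} : u a_{l+1}))`. [folklore] -/
theorem prod_range_den_succ {k i : ℕ} (hi : i < k) (u : ℝ) (a : ℕ → ℝ) :
    (∏ l ∈ range k, (1 - (if l + 1 ≤ i then a (l + 1) else u * a (l + 1)))) * (1 - a (i + 1)) =
      (∏ l ∈ range k, (1 - (if l + 1 ≤ i + 1 then a (l + 1) else u * a (l + 1)))) *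
        (1 - u * a (i + 1)) := by
  have hmem : i ∈ range k := mem_range.mpr hi
  rw [← mul_prod_erase (range k) _ hmem, ← mul_prod_erase (range k) _ hmem]
  rw [if_neg (by omega), if_pos le_rfl]
  have : ∏ l ∈ (range k).erase i, (1 - (if l + 1 ≤ i then a (l + 1) else u * a (l + 1))) =
      ∏ l ∈ (range k).erase i, (1 - (if l + 1 ≤ i + 1 then a (l + 1) else u * a (l + 1))) := by
    refine prod_congr rfl fun l hl => ?_
    have hli : l ≠ i := (mem_erase.mp hl).1
    by_cases h : l + 1 ≤ i
    · rw [if_pos h, if_pos (by omega)]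
    · rw [if_neg h, if_neg (by omega)]
  rw [this]
  ring

/-- `u a < 1` for `0 < u < 1` and `a < 1`. [folklore] -/
theorem mul_lt_one_of_lt {u a : ℝ} (hu0 : 0 < u) (hu1 : u < 1) (ha : a < 1) : u * a < 1 := by
  rcases le_or_gt 0 a with ha0 | ha0
  · calc u * a ≤ 1 * a := mul_le_mul_of_nonneg_right hu1.le ha0
      _ = a := one_mul a
      _ < 1 := ha
  · have : u * a < 0 := mul_neg_of_pos_of_neg hu0 ha0
    linarith

/-- The telescoping denominators do not vanish. [folklore] -/
theorem prod_range_den_ne_zero (k m : ℕ) {u : ℝ} (hu0 : 0 < u) (hu1 : u < 1) {a : ℕ → ℝ}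
    (ha : ∀ j, 1 ≤ j → a j < 1) :
    ∏ l ∈ range k, (1 - (if l + 1 ≤ m then a (l + 1) else u * a (l + 1))) ≠ 0 := by
  refine prod_ne_zero_iff.mpr fun l _ => ?_
  split_ifs
  · exact (sub_pos.mpr (ha (l + 1) (Nat.succ_pos l))).ne'
  · exact (sub_pos.mpr (mul_lt_one_of_lt hu0 hu1 (ha (l + 1) (Nat.succ_pos l)))).ne'

/-- **One block of the stuffle dissection**: `g_i + h_i = A · (Q_{i+1} − Q_i)/(1 − u)` with
`Q_m = u^{k−m}/∏_{l<k}(1 − (l+1 ≤ m ? a_{l+1} : u a_{l+1}))` and `A = ∏_{l<k} a_l`. [folklore] -/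
theorem stuffle_block {k i : ℕ} (hi : i < k) {u : ℝ} (hu0 : 0 < u) (hu1 : u < 1) {a : ℕ → ℝ}
    (ha : ∀ j, 1 ≤ j → a j < 1) :
    (∏ l ∈ range k, (if l ≤ i then a l else u * a l) /
        (1 - (if l + 1 ≤ i then a (l + 1) else u * a (l + 1)))) +
      ∏ l ∈ range (k + 1), (if l ≤ i + 1 then a l else u * a (l - 1)) /
        (1 - (if l ≤ i then a (l + 1) else u * a l)) =
    (∏ l ∈ range k, a l) *
      (u ^ (k - (i + 1)) / ∏ l ∈ range k, (1 - (if l + 1 ≤ i + 1 then a (l + 1) else u * a (l + 1))) -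
        u ^ (k - i) / ∏ l ∈ range k, (1 - (if l + 1 ≤ i then a (l + 1) else u * a (l + 1)))) /
      (1 - u) := by
  rw [prod_div_distrib, prod_div_distrib, prod_range_insertNum hi, prod_range_insertDen hi,
    prod_range_raiseNum, show k - 1 - i = k - (i + 1) by omega]
  have hGG' := prod_range_den_succ hi u a
  set G := ∏ l ∈ range k, (1 - (if l + 1 ≤ i then a (l + 1) else u * a (l + 1))) with hG
  set G' := ∏ l ∈ range k, (1 - (if l + 1 ≤ i + 1 then a (l + 1) else u * a (l + 1))) with hG'
  set A := ∏ l ∈ range k, a l with hA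
  have ha1 : 1 - a (i + 1) ≠ 0 := (sub_pos.mpr (ha (i + 1) (Nat.succ_pos i))).ne'
  have hua : 1 - u * a (i + 1) ≠ 0 :=
    (sub_pos.mpr (mul_lt_one_of_lt hu0 hu1 (ha (i + 1) (Nat.succ_pos i)))).ne'
  have hGne : G ≠ 0 := prod_range_den_ne_zero k i hu0 hu1 ha
  have hu : 1 - u ≠ 0 := (sub_pos.mpr hu1).ne'
  have hG'eq : G' = G * (1 - a (i + 1)) / (1 - u * a (i + 1)) := by
    rw [eq_div_iff hua, ← hGG']
  rw [hG'eq]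
  have hpow : u ^ (k - i) = u ^ (k - (i + 1)) * u := by
    rw [← pow_succ]; congr 1; omega
  rw [hpow]
  field_simp
  ring

/-- **The stuffle dissection identity** (telescoping over the blocks): for `a 0 = 1`,
`a_j < 1` (`j ≥ 1`), `0 < u < 1`,
`(∏_{l<k} a_l/(1−a_{l+1}) − u·∏_{l<k} (l = 0 ? 1 : u) a_l/(1 − u a_{l+1}))/(1 − u) = ∑_{i<k} (g_i + h_i)`.
[cite: IharaKanekoZagier2006, Thm 2] -/
theorem stuffle_telescope {k : ℕ} (hk : 1 ≤ k) {u : ℝ} (hu0 : 0 < u) (hu1 : u < 1) {a : ℕ → ℝ}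
    (ha : ∀ j, 1 ≤ j → a j < 1) :
    ((∏ l ∈ range k, a l / (1 - a (l + 1))) -
        u * ∏ l ∈ range k, (if l = 0 then 1 else u) * a l / (1 - u * a (l + 1))) / (1 - u) =
      ∑ i ∈ range k,
        ((∏ l ∈ range k, (if l ≤ i then a l else u * a l) /
            (1 - (if l + 1 ≤ i then a (l + 1) else u * a (l + 1)))) +
          ∏ l ∈ range (k + 1), (if l ≤ i + 1 then a l else u * a (l - 1)) /
            (1 - (if l ≤ i then a (l + 1) else u * a l))) := by
  rw [sum_congr rfl fun i hi => stuffle_block (mem_range.mp hi) hu0 hu1 ha]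
  have htel := sum_range_sub (fun m => (∏ l ∈ range k, a l) * (u ^ (k - m) /
    ∏ l ∈ range k, (1 - (if l + 1 ≤ m then a (l + 1) else u * a (l + 1)))) / (1 - u)) k
  have hsplit : (∑ i ∈ range k, (∏ l ∈ range k, a l) *
      (u ^ (k - (i + 1)) / ∏ l ∈ range k, (1 - (if l + 1 ≤ i + 1 then a (l + 1) else u * a (l + 1))) -
        u ^ (k - i) / ∏ l ∈ range k, (1 - (if l + 1 ≤ i then a (l + 1) else u * a (l + 1)))) /
      (1 - u)) = ∑ i ∈ range k,
      ((∏ l ∈ range k, a l) * (u ^ (k - (i + 1)) /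
        ∏ l ∈ range k, (1 - (if l + 1 ≤ i + 1 then a (l + 1) else u * a (l + 1)))) / (1 - u) -
       (∏ l ∈ range k, a l) * (u ^ (k - i) /
        ∏ l ∈ range k, (1 - (if l + 1 ≤ i then a (l + 1) else u * a (l + 1)))) / (1 - u)) :=
    sum_congr rfl fun i _ => by ring
  rw [hsplit, htel]
  have hQk : ∏ l ∈ range k, (1 - (if l + 1 ≤ k then a (l + 1) else u * a (l + 1))) =
      ∏ l ∈ range k, (1 - a (l + 1)) :=
    prod_congr rfl fun l hl => by rw [if_pos (show l + 1 ≤ k from mem_range.mp hl)]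
  have hQ0 : ∏ l ∈ range k, (1 - (if l + 1 ≤ 0 then a (l + 1) else u * a (l + 1))) =
      ∏ l ∈ range k, (1 - u * a (l + 1)) :=
    prod_congr rfl fun l _ => by rw [if_neg (Nat.not_succ_le_zero l)]
  rw [Nat.sub_self, pow_zero, Nat.sub_zero, hQk, hQ0, prod_div_distrib, prod_div_distrib,
    prod_mul_distrib]
  have hu' : ∏ l ∈ range k, (if l = 0 then (1 : ℝ) else u) = u ^ (k - 1) := by
    obtain ⟨k', rfl⟩ := Nat.exists_eq_add_of_le' hk
    rw [prod_range_succ', if_pos rfl, mul_one, Nat.add_sub_cancel,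
      prod_congr rfl fun l _ => if_neg (Nat.succ_ne_zero l), prod_const, card_range]
  rw [hu']
  have hD : ∏ l ∈ range k, (1 - a (l + 1)) ≠ 0 :=
    prod_ne_zero_iff.mpr fun l _ => (sub_pos.mpr (ha (l + 1) (Nat.succ_pos l))).ne'
  have hF : ∏ l ∈ range k, (1 - u * a (l + 1)) ≠ 0 :=
    prod_ne_zero_iff.mpr fun l _ =>
      (sub_pos.mpr (mul_lt_one_of_lt hu0 hu1 (ha (l + 1) (Nat.succ_pos l)))).ne'
  have hu : 1 - u ≠ 0 := (sub_pos.mpr hu1).ne'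
  have hpow : u ^ k = u * u ^ (k - 1) := by
    rw [← pow_succ', Nat.sub_add_cancel hk]
  rw [hpow]
  field_simp

/-! ### Partial products at permuted and sheared points -/

/-- **Partial products at the point with `y 0` inserted at slot `P`.** Reading `y = (u, x)` and
`w = (x₀,…,x_{P−1}, u, x_P, …)`, i.e. `w j = y (P.cycleRange j)`: `∏_{j<m} w_j = ∏_{j<m} x_j` for
`m ≤ P` and `= u · ∏_{j<m-1} x_j` for `m > P`. [folklore] -/
theorem prod_ite_cycleRange {n : ℕ} (y : Fin (n + 1) → ℝ) (P : Fin (n + 1)) (m : ℕ) :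
    ∏ j : Fin (n + 1), (if (j : ℕ) < m then y (P.cycleRange j) else 1) =
      if m ≤ (P : ℕ) then ∏ i : Fin n, (if (i : ℕ) < m then y i.succ else 1)
      else y 0 * ∏ i : Fin n, (if (i : ℕ) < m - 1 then y i.succ else 1) := by
  rw [Fin.prod_univ_succAbove _ P]
  simp only [Fin.cycleRange_self, Fin.cycleRange_succAbove]
  by_cases hm : m ≤ (P : ℕ)
  · rw [if_pos hm, if_neg (not_lt.mpr hm), one_mul]
    refine Finset.prod_congr rfl fun i _ => ?_
    by_cases hi : Fin.castSucc i < P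
    · rw [Fin.succAbove_of_castSucc_lt _ _ hi, Fin.val_castSucc]
    · rw [Fin.succAbove_of_le_castSucc _ _ (not_lt.mp hi), Fin.val_succ]
      have hPi : (P : ℕ) ≤ i := by
        have := not_lt.mp hi; rwa [Fin.le_def, Fin.val_castSucc] at this
      rw [if_neg (by omega), if_neg (by omega)]
  · rw [if_neg hm, if_pos (not_le.mp hm)]
    congr 1
    refine Finset.prod_congr rfl fun i _ => ?_
    by_cases hi : Fin.castSucc i < P
    · rw [Fin.succAbove_of_castSucc_lt _ _ hi, Fin.val_castSucc]
      have hiP : (i : ℕ) < P := by rwa [Fin.lt_def, Fin.val_castSucc] at hi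
      rw [if_pos (by omega), if_pos (by omega)]
    · rw [Fin.succAbove_of_le_castSucc _ _ (not_lt.mp hi), Fin.val_succ]
      by_cases h : (i : ℕ) + 1 < m
      · rw [if_pos h, if_pos (by omega)]
      · rw [if_neg h, if_neg (by omega)]

/-- **Partial products at the sheared point** `σ_c x = (c x₀, x₁, …)`: `∏_{j<m} (σ_c x)_j = c^{[m>0]} ∏_{j<m} x_j`.
[folklore] -/
theorem prod_ite_shear {n : ℕ} (hn : 0 < n) (c : ℝ) (x z : Fin n → ℝ)
    (hz : ∀ j, z j = if (j : ℕ) = 0 then c * x j else x j) (m : ℕ) :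
    ∏ j : Fin n, (if (j : ℕ) < m then z j else 1) =
      (if 0 < m then c else 1) * ∏ j : Fin n, (if (j : ℕ) < m then x j else 1) := by
  obtain ⟨n, rfl⟩ := Nat.exists_eq_succ_of_ne_zero hn.ne'
  rw [Fin.prod_univ_succ, Fin.prod_univ_succ]
  have h0 : z 0 = c * x 0 := by rw [hz]; simp
  have hs : ∀ j : Fin n, z j.succ = x j.succ := fun j => by rw [hz]; simp
  simp only [Fin.val_zero, h0, hs]
  by_cases hm : 0 < m
  · rw [if_pos hm, if_pos hm, if_pos hm]; ring
  · rw [if_neg hm, if_neg hm, if_neg hm]; ring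

/-- Non-empty partial products of a point of the open cube are `< 1`. [folklore] -/
theorem prod_ite_lt_one {n : ℕ} (hn : 0 < n) (x : Fin n → ℝ) (hx : ∀ i, x i ∈ Set.Ioo (0 : ℝ) 1)
    {m : ℕ} (hm : 0 < m) :
    ∏ j : Fin n, (if (j : ℕ) < m then x j else 1) < 1 := by
  obtain ⟨n, rfl⟩ := Nat.exists_eq_succ_of_ne_zero hn.ne'
  rw [Fin.prod_univ_succ, Fin.val_zero, if_pos hm]
  refine mul_lt_one_of_nonneg_of_lt_one_left (hx 0).1.le (hx 0).2 ?_
  exact prod_le_one (fun j _ => by split_ifs <;> [exact (hx _).1.le; exact zero_le_one])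
    fun j _ => by split_ifs <;> [exact (hx _).2.le; exact le_rfl]

/-! ### Block ends of the raised and inserted indices -/

/-- Raising position `0`. [folklore] -/
theorem raise'_cons_zero (b : ℕ) (t : List ℕ) :
    (b :: t).take 0 ++ [(b :: t).getD 0 0 + 1] ++ (b :: t).drop (0 + 1) = (b + 1) :: t := by
  simp

/-- Raising a later position commutes with `cons`. [folklore] -/
theorem raise'_cons_succ (b : ℕ) (t : List ℕ) (i : ℕ) :
    (b :: t).take (i + 1) ++ [(b :: t).getD (i + 1) 0 + 1] ++ (b :: t).drop (i + 1 + 1) =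
      b :: (t.take i ++ [t.getD i 0 + 1] ++ t.drop (i + 1)) := by
  simp

/-- Inserting `1` after block `0`. [folklore] -/
theorem insertOne_cons_zero (b : ℕ) (t : List ℕ) :
    (b :: t).take (0 + 1) ++ [1] ++ (b :: t).drop (0 + 1) = b :: 1 :: t := by
  simp

/-- Inserting `1` after a later block commutes with `cons`. [folklore] -/
theorem insertOne_cons_succ (b : ℕ) (t : List ℕ) (i : ℕ) :
    (b :: t).take (i + 1 + 1) ++ [1] ++ (b :: t).drop (i + 1 + 1) =
      b :: (t.take (i + 1) ++ [1] ++ t.drop (i + 1)) := by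
  simp

/-- The raised index has the same length. [folklore] -/
theorem length_raise' : ∀ (s : List ℕ) (i : ℕ), i < s.length →
    (s.take i ++ [s.getD i 0 + 1] ++ s.drop (i + 1)).length = s.length
  | [], i, hi => by simp at hi
  | b :: t, 0, _ => by rw [raise'_cons_zero]; rfl
  | b :: t, i + 1, hi => by
    rw [raise'_cons_succ, List.length_cons, List.length_cons,
      length_raise' t i (by simpa using hi)]

/-- The inserted index is one longer. [folklore] -/
theorem length_insertOne : ∀ (s : List ℕ) (i : ℕ), i < s.length →
    (s.take (i + 1) ++ [1] ++ s.drop (i + 1)).length = s.length + 1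
  | [], i, hi => by simp at hi
  | b :: t, 0, _ => by rw [insertOne_cons_zero]; rfl
  | b :: t, i + 1, hi => by
    rw [insertOne_cons_succ, List.length_cons, List.length_cons,
      length_insertOne t i (by simpa using hi)]

/-- The raised index has weight one more. [folklore] -/
theorem sum_raise' : ∀ (s : List ℕ) (i : ℕ), i < s.length →
    (s.take i ++ [s.getD i 0 + 1] ++ s.drop (i + 1)).sum = s.sum + 1
  | [], i, hi => by simp at hi
  | b :: t, 0, _ => by rw [raise'_cons_zero, List.sum_cons, List.sum_cons]; ring
  | b :: t, i + 1, hi => by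
    rw [raise'_cons_succ, List.sum_cons, List.sum_cons, sum_raise' t i (by simpa using hi)]
    ring

/-- The inserted index has weight one more. [folklore] -/
theorem sum_insertOne : ∀ (s : List ℕ) (i : ℕ), i < s.length →
    (s.take (i + 1) ++ [1] ++ s.drop (i + 1)).sum = s.sum + 1
  | [], i, hi => by simp at hi
  | b :: t, 0, _ => by rw [insertOne_cons_zero, List.sum_cons, List.sum_cons, List.sum_cons]; ring
  | b :: t, i + 1, hi => by
    rw [insertOne_cons_succ, List.sum_cons, List.sum_cons, sum_insertOne t i (by simpa using hi)]
    ring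

/-- **Block ends of the raised index**: `p'_m = p_m` for `m ≤ i` and `p_m + 1` for `m > i`. [folklore] -/
theorem sum_take_raise' : ∀ (s : List ℕ) (i m : ℕ), i < s.length →
    ((s.take i ++ [s.getD i 0 + 1] ++ s.drop (i + 1)).take m).sum =
      if m ≤ i then (s.take m).sum else (s.take m).sum + 1
  | [], i, m, hi => by simp at hi
  | b :: t, 0, 0, _ => by simp
  | b :: t, 0, m + 1, _ => by
    rw [raise'_cons_zero, List.take_succ_cons, List.take_succ_cons, List.sum_cons, List.sum_cons,
      if_neg (Nat.not_succ_le_zero m)]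
    ring
  | b :: t, i + 1, 0, _ => by simp
  | b :: t, i + 1, m + 1, hi => by
    rw [raise'_cons_succ, List.take_succ_cons, List.take_succ_cons, List.sum_cons, List.sum_cons,
      sum_take_raise' t i m (by simpa using hi)]
    by_cases hm : m ≤ i
    · rw [if_pos hm, if_pos (Nat.succ_le_succ hm)]
    · rw [if_neg hm, if_neg (fun h => hm (Nat.le_of_succ_le_succ h))]; ring

/-- **Block ends of the inserted index**: `p''_m = p_m` for `m ≤ i + 1` and `p_{m-1} + 1` for
`m ≥ i + 2`. [folklore] -/
theorem sum_take_insertOne : ∀ (s : List ℕ) (i m : ℕ), i < s.length →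
    ((s.take (i + 1) ++ [1] ++ s.drop (i + 1)).take m).sum =
      if m ≤ i + 1 then (s.take m).sum else (s.take (m - 1)).sum + 1
  | [], i, m, hi => by simp at hi
  | b :: t, 0, 0, _ => by simp
  | b :: t, 0, 1, _ => by simp
  | b :: t, 0, m + 2, _ => by
    rw [insertOne_cons_zero, List.take_succ_cons, List.take_succ_cons, List.sum_cons, List.sum_cons,
      if_neg (by omega), show m + 2 - 1 = m + 1 from rfl, List.take_succ_cons, List.sum_cons]
    ring
  | b :: t, i + 1, 0, _ => by simp
  | b :: t, i + 1, m + 1, hi => by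
    rw [insertOne_cons_succ, List.take_succ_cons, List.sum_cons,
      sum_take_insertOne t i m (by simpa using hi)]
    by_cases hm : m ≤ i + 1
    · rw [if_pos hm, if_pos (Nat.succ_le_succ hm), List.take_succ_cons, List.sum_cons]
    · rw [if_neg hm, if_neg (fun h => hm (Nat.le_of_succ_le_succ h))]
      obtain ⟨m', rfl⟩ := Nat.exists_eq_succ_of_ne_zero (by omega : m ≠ 0)
      rw [show m' + 1 + 1 - 1 = m' + 1 from rfl, show m' + 1 - 1 = m' from rfl, List.take_succ_cons,
        List.sum_cons]
      ring

/-- Block ends are monotone: `p_m ≤ p_{m'}` for `m ≤ m'`. [folklore] -/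
theorem sum_take_mono : ∀ (s : List ℕ) {m m' : ℕ}, m ≤ m' → (s.take m).sum ≤ (s.take m').sum
  | [], m, m', _ => by simp
  | b :: t, 0, m', _ => by simp
  | b :: t, m + 1, m' + 1, h => by
    rw [List.take_succ_cons, List.take_succ_cons, List.sum_cons, List.sum_cons]
    exact Nat.add_le_add_left (sum_take_mono t (Nat.le_of_succ_le_succ h)) b

/-- Block ends are bounded by the weight: `p_m ≤ n`. [folklore] -/
theorem sum_take_le_sum (s : List ℕ) (m : ℕ) : (s.take m).sum ≤ s.sum := by
  have := List.sum_take_add_sum_drop s m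
  omega

/-- Block ends after the first are positive: `0 < p_m` for `m ≥ 1` when the head is positive. [folklore] -/
theorem sum_take_pos {b : ℕ} (hb : 0 < b) (t : List ℕ) {m : ℕ} (hm : 0 < m) :
    0 < ((b :: t).take m).sum := by
  obtain ⟨m, rfl⟩ := Nat.exists_eq_succ_of_ne_zero hm.ne'
  rw [List.take_succ_cons, List.sum_cons]
  omega

/-! ### Registered sub-goal -/

/-- SUB-GOAL STUB of `stub_stuffleDissection` (registered on stmt-KontsevichZagierPeriods-3930): the telescoping
block-partial-fraction identity `stuffle_telescope`, quantifiers spelled out. [cite: IharaKanekoZagier2006, Thm 2] -/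
theorem stub_stuffleTelescope : ∀ (k : ℕ), 1 ≤ k → ∀ (u : ℝ), 0 < u → u < 1 → ∀ (a : ℕ → ℝ), (∀ j, 1 ≤ j → a j < 1) → ((∏ l ∈ Finset.range k, a l / (1 - a (l + 1))) - u * ∏ l ∈ Finset.range k, (if l = 0 then 1 else u) * a l / (1 - u * a (l + 1))) / (1 - u) = ∑ i ∈ Finset.range k, ((∏ l ∈ Finset.range k, (if l ≤ i then a l else u * a l) / (1 - (if l + 1 ≤ i then a (l + 1) else u * a (l + 1)))) + ∏ l ∈ Finset.range (k + 1), (if l ≤ i + 1 then a l else u * a (l - 1)) / (1 - (if l ≤ i then a (l + 1) else u * a l))) :=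
  fun _ hk _ hu0 hu1 _ ha => stuffle_telescope hk hu0 hu1 ha

end Summit.KontsevichZagierPeriods.FurushoPentagon.HoffmanRelationInKZ
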